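import Mathlib
import HarnessLib
import Literature.Geometry.DiscreteGeometry.TammesThirteen
import Summits.AtomisticToContinuum.Crystallization.Theorems.PricedLinkCensusSoftFourRingsFacetCap

/-!
# The corner cap: every facet corner of the twelve link directions is below `136.9°`

Route `PricedLinkCensus`, item `SoftFourRings` (stmt-AtomisticToContinuum-14234), evidence
`softrings-search.md` §12.2.  Let `c` support `X` (`⟪c, ·⟫ ≤ 1` on `X`) and let `v, u, u'` be
tight (`= 1`), i.e. vertices of one facet, cocircular about the axis `c/‖c‖` at angular radius `R`,
`cos² R = 1/‖c‖²`.  In the tangent plane at `v` the direction towards the axis is `c − v`, and the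
direction `u − ⟪v,u⟫ v` towards another tight point makes an angle `β` with it,
`cos β = ⟪u − ⟪v,u⟫v, c − v⟫/(‖·‖‖·‖) = √((1 − p)/((1 + p)(‖c‖² − 1)))` (`p = ⟪v, u⟫`; this is
`cot R · tan (a/2)`, `a = ∠(v,u)`), so separation `p ≤ ca` and a small cap (`‖c‖² − 1` small) force
`cos β ≥ κ` (`inner_sub_smul_sub_ge`); two such directions then make an angle `≤ 2 arccos κ`, i.e.
`cos ≥ 2κ² − 1` (`inner_ge_of_inner_ge_mul_norm`, Cauchy–Schwarz orthogonally to `c − v`).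
For at least twelve unit vectors pairwise at inner product `≤ ca = 1 − 1/(2·(101/100)²)` and
CONDITIONAL on Tammes-13 (`FacetCap`: `‖c‖ < 2/(2 − 0.957²)`), `κ² = 135/1000` works and every
facet corner has cosine `≥ −0.73`, i.e. is `< 136.9°` (`facet_corner_cos_ge_one_percent`).
Consequence (evidence §12.2): the lone non-triangle gap (`≥ 144.3°`, cosine `≤ −0.81`) at a vertex
with three bond triangles is never a single facet corner — a non-bond hull edge issues from every such
vertex — which, with `#non-bond hull edges ≤ 6`, kills the hexagonal antiprism by counting.
-/

namespace Summit.AtomisticToContinuum.Crystallization.Theorems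

open Real RealInnerProductSpace Literature.Geometry.DiscreteGeometry

/-- **Angle addition about a common direction** (any real inner product space): if `‖g‖ = 1`,
`0 ≤ κ`, `2κ² ≤ 1`, and `t, t'` both make an angle `≤ arccos κ` with `g`
(`κ‖t‖ ≤ ⟪t, g⟫`, `κ‖t'‖ ≤ ⟪t', g⟫`), then the angle between `t` and `t'` is `≤ 2 arccos κ`:
`(2κ² − 1)‖t‖‖t'‖ ≤ ⟪t, t'⟫`. [folklore] -/
theorem inner_ge_of_inner_ge_mul_norm {E : Type*} [NormedAddCommGroup E] [InnerProductSpace ℝ E]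
    {g t t' : E} (hg : ‖g‖ = 1) {κ : ℝ} (hκ0 : 0 ≤ κ) (h2κ : 2 * κ ^ 2 ≤ 1)
    (ht : κ * ‖t‖ ≤ ⟪t, g⟫) (ht' : κ * ‖t'‖ ≤ ⟪t', g⟫) :
    (2 * κ ^ 2 - 1) * (‖t‖ * ‖t'‖) ≤ ⟪t, t'⟫ := by
  obtain ⟨a, ha⟩ : ∃ A : ℝ, A = ⟪t, g⟫ := ⟨_, rfl⟩
  obtain ⟨a', ha'⟩ : ∃ A : ℝ, A = ⟪t', g⟫ := ⟨_, rfl⟩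
  rw [← ha] at ht
  rw [← ha'] at ht'
  have hgg : ⟪g, g⟫ = 1 := by rw [real_inner_self_eq_norm_sq, hg]; norm_num
  set r : E := t - a • g with hr
  set r' : E := t' - a' • g with hr'
  have hT : ‖t‖ ^ 2 = a ^ 2 + ‖r‖ ^ 2 := by
    rw [← real_inner_self_eq_norm_sq, ← real_inner_self_eq_norm_sq, hr, inner_sub_left,
      inner_sub_right, inner_sub_right, real_inner_smul_left, real_inner_smul_right,
      real_inner_smul_left, real_inner_smul_right, hgg, real_inner_comm t g, ← ha]
    ring
  have hT' : ‖t'‖ ^ 2 = a' ^ 2 + ‖r'‖ ^ 2 := by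
    rw [← real_inner_self_eq_norm_sq, ← real_inner_self_eq_norm_sq, hr', inner_sub_left,
      inner_sub_right, inner_sub_right, real_inner_smul_left, real_inner_smul_right,
      real_inner_smul_left, real_inner_smul_right, hgg, real_inner_comm t' g, ← ha']
    ring
  have hdec : ⟪t, t'⟫ = a * a' + ⟪r, r'⟫ := by
    rw [hr, hr', inner_sub_left, inner_sub_right, inner_sub_right, real_inner_smul_left,
      real_inner_smul_right, real_inner_smul_left, real_inner_smul_right, hgg,
      real_inner_comm t' g, ← ha', ← ha]
    ring
  have hcs : -(‖r‖ * ‖r'‖) ≤ ⟪r, r'⟫ := by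
    have := abs_real_inner_le_norm r r'
    have := neg_abs_le ⟪r, r'⟫
    linarith
  -- scalar inequality: `a a' − ‖r‖‖r'‖ ≥ (2κ² − 1) ‖t‖ ‖t'‖`
  have hTn := norm_nonneg t
  have hTn' := norm_nonneg t'
  have hrn := norm_nonneg r
  have hrn' := norm_nonneg r'
  have ha0 : 0 ≤ a := le_trans (mul_nonneg hκ0 hTn) ht
  have ha0' : 0 ≤ a' := le_trans (mul_nonneg hκ0 hTn') ht'
  set C : ℝ := 1 - 2 * κ ^ 2 with hC
  have hC0 : 0 ≤ C := by rw [hC]; linarith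
  have hL0 : 0 ≤ a * a' + C * (‖t‖ * ‖t'‖) := by positivity
  have hkey : (‖r‖ * ‖r'‖) ^ 2 ≤ (a * a' + C * (‖t‖ * ‖t'‖)) ^ 2 := by
    have hr2 : ‖r‖ ^ 2 = ‖t‖ ^ 2 - a ^ 2 := by linarith
    have hr2' : ‖r'‖ ^ 2 = ‖t'‖ ^ 2 - a' ^ 2 := by linarith
    have haa : κ ^ 2 * (‖t‖ * ‖t'‖) ≤ a * a' := by
      have := mul_le_mul ht ht' (mul_nonneg hκ0 hTn') ha0
      nlinarith [this]
    have hid : (a * a' + C * (‖t‖ * ‖t'‖)) ^ 2 - (‖t‖ ^ 2 - a ^ 2) * (‖t'‖ ^ 2 - a' ^ 2) =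
        2 * C * (a * a') * (‖t‖ * ‖t'‖) + (a * ‖t'‖) ^ 2 + (a' * ‖t‖) ^ 2
          - (1 - C ^ 2) * (‖t‖ * ‖t'‖) ^ 2 := by ring
    have hamgm : 2 * (a * a') * (‖t‖ * ‖t'‖) ≤ (a * ‖t'‖) ^ 2 + (a' * ‖t‖) ^ 2 := by
      nlinarith [sq_nonneg (a * ‖t'‖ - a' * ‖t‖)]
    have h1C : 1 - C ^ 2 = 4 * κ ^ 2 * (1 - κ ^ 2) := by rw [hC]; ring
    rw [mul_pow, hr2, hr2']
    have hTT := mul_nonneg hTn hTn'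
    nlinarith [mul_le_mul_of_nonneg_left haa (mul_nonneg (by positivity : (0 : ℝ) ≤ 2 * C) hTT),
      mul_le_mul_of_nonneg_left haa (mul_nonneg (by positivity : (0 : ℝ) ≤ 4 * κ ^ 2) hTT),
      hamgm, hTT]
  have hle : ‖r‖ * ‖r'‖ ≤ a * a' + C * (‖t‖ * ‖t'‖) :=
    (pow_le_pow_iff_left₀ (mul_nonneg hrn hrn') hL0 two_ne_zero).1 hkey
  rw [hdec, hC] at *
  nlinarith [hle, hcs]

/-- Two distinct unit tight points force `‖c‖ > 1`. [folklore] -/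
theorem one_lt_norm_of_two_tight {c u v : EuclideanSpace ℝ (Fin 3)} (hu : ‖u‖ = 1)
    (hv : ‖v‖ = 1) (huv : u ≠ v) (hcu : ⟪c, u⟫ = 1) (hcv : ⟪c, v⟫ = 1) : 1 < ‖c‖ := by
  by_contra hle
  push Not at hle
  have key : ∀ y : EuclideanSpace ℝ (Fin 3), ‖y‖ = 1 → ⟪c, y⟫ = 1 → y = c := by
    intro y hy hcy
    have h1 : ⟪c, y⟫ ≤ ‖c‖ * ‖y‖ := real_inner_le_norm c y
    rw [hcy, hy, mul_one] at h1
    have hc1 : ‖c‖ = 1 := le_antisymm hle h1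
    have h0 : ‖c - y‖ ^ 2 = 0 := by
      rw [← real_inner_self_eq_norm_sq, inner_sub_left, inner_sub_right, inner_sub_right,
        real_inner_self_eq_norm_sq, real_inner_self_eq_norm_sq, hc1, hy, real_inner_comm c y, hcy]
      norm_num
    rw [sq_eq_zero_iff, norm_eq_zero, sub_eq_zero] at h0
    exact h0.symm
  exact huv ((key u hu hcu).trans (key v hv hcv).symm)

/-- **Towards the axis.**  `v, u` unit and tight for `c` (`⟪c, v⟫ = ⟪c, u⟫ = 1`),
`⟪v, u⟫ ≤ ca < 1`, smallness `κ²(1 + ca)(‖c‖² − 1) ≤ 1 − ca` with `0 ≤ κ`: the tangent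
direction at `v` towards `u` makes an angle `≤ arccos κ` with the tangent direction `c − v`
towards the facet axis: `κ ‖u − ⟪v,u⟫v‖ ‖c − v‖ ≤ ⟪u − ⟪v,u⟫v, c − v⟫ (= 1 − ⟪v,u⟫)`.
[folklore] -/
theorem inner_sub_smul_sub_ge {c v u : EuclideanSpace ℝ (Fin 3)} (hv : ‖v‖ = 1) (hu : ‖u‖ = 1)
    (hcv : ⟪c, v⟫ = 1) (hcu : ⟪c, u⟫ = 1) {ca κ : ℝ} (hca1 : ca < 1)
    (hp : ⟪v, u⟫ ≤ ca) (hκ0 : 0 ≤ κ) (hsmall : κ ^ 2 * (1 + ca) * (‖c‖ ^ 2 - 1) ≤ 1 - ca) :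
    κ * (‖u - ⟪v, u⟫ • v‖ * ‖c - v‖) ≤ ⟪u - ⟪v, u⟫ • v, c - v⟫ := by
  have hc1 : 1 ≤ ‖c‖ := by
    have := real_inner_le_norm c v
    rw [hcv, hv, mul_one] at this
    exact this
  obtain ⟨p, hpdef⟩ : ∃ P : ℝ, P = ⟪v, u⟫ := ⟨_, rfl⟩
  rw [← hpdef] at hp ⊢
  have hvv : ⟪v, v⟫ = 1 := by rw [real_inner_self_eq_norm_sq, hv]; norm_num
  have huu : ⟪u, u⟫ = 1 := by rw [real_inner_self_eq_norm_sq, hu]; norm_num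
  have hval : ⟪u - p • v, c - v⟫ = 1 - p := by
    rw [inner_sub_left, inner_sub_right, inner_sub_right, real_inner_smul_left,
      real_inner_smul_left, real_inner_comm c u, hcu, real_inner_comm v u, ← hpdef,
      real_inner_comm c v, hcv, hvv]
    ring
  have ht2 : ‖u - p • v‖ ^ 2 = 1 - p ^ 2 := by
    rw [← real_inner_self_eq_norm_sq, inner_sub_left, inner_sub_right, inner_sub_right,
      real_inner_smul_left, real_inner_smul_right, real_inner_smul_left, real_inner_smul_right,
      huu, hvv, real_inner_comm v u, ← hpdef]
    ring
  have hg2 : ‖c - v‖ ^ 2 = ‖c‖ ^ 2 - 1 := by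
    rw [← real_inner_self_eq_norm_sq, ← real_inner_self_eq_norm_sq, inner_sub_left,
      inner_sub_right, inner_sub_right, hcv, real_inner_comm c v, hcv, hvv]
    ring
  have hp1 : p ≤ 1 := by
    have := real_inner_le_norm v u
    rw [hv, hu, ← hpdef] at this; linarith
  have hpm1 : -1 ≤ p := by
    have := neg_le_of_abs_le (abs_real_inner_le_norm v u)
    rw [hv, hu, ← hpdef] at this; linarith
  rw [hval]
  -- square both sides
  have hL0 : 0 ≤ 1 - p := by linarith
  have hprod0 : 0 ≤ κ * (‖u - p • v‖ * ‖c - v‖) := by positivity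
  have hsq : (κ * (‖u - p • v‖ * ‖c - v‖)) ^ 2 ≤ (1 - p) ^ 2 := by
    rw [mul_pow, mul_pow, ht2, hg2]
    have hc2 : 0 ≤ ‖c‖ ^ 2 - 1 := by nlinarith
    have h1 : κ ^ 2 * ((1 - p ^ 2) * (‖c‖ ^ 2 - 1)) = (1 - p) * (κ ^ 2 * (1 + p) * (‖c‖ ^ 2 - 1)) := by
      ring
    rw [h1]
    have h2 : κ ^ 2 * (1 + p) * (‖c‖ ^ 2 - 1) ≤ κ ^ 2 * (1 + ca) * (‖c‖ ^ 2 - 1) := by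
      have := mul_le_mul_of_nonneg_left (show 1 + p ≤ 1 + ca by linarith) (sq_nonneg κ)
      exact mul_le_mul_of_nonneg_right this hc2
    nlinarith [mul_le_mul_of_nonneg_left (h2.trans hsmall) hL0]
  exact (pow_le_pow_iff_left₀ hprod0 hL0 two_ne_zero).1 hsq

/-- **The corner cap** (general constants).  `v, u, u'` unit and tight for `c`, `u ≠ v`, `u' ≠ v`,
separation `⟪v, u⟫, ⟪v, u'⟫ ≤ ca < 1`, `0 ≤ κ`, `2κ² ≤ 1`, smallness
`κ²(1 + ca)(‖c‖² − 1) ≤ 1 − ca`: the corner at `v` between `u` and `u'` has cosine `≥ 2κ² − 1`: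
`(2κ² − 1) ‖u − ⟪v,u⟫v‖ ‖u' − ⟪v,u'⟫v‖ ≤ ⟪u − ⟪v,u⟫v, u' − ⟪v,u'⟫v⟫`. [folklore] -/
theorem facet_corner_cos_ge {c v u u' : EuclideanSpace ℝ (Fin 3)} (hv : ‖v‖ = 1) (hu : ‖u‖ = 1)
    (hu' : ‖u'‖ = 1) (huv : u ≠ v) (hcv : ⟪c, v⟫ = 1) (hcu : ⟪c, u⟫ = 1) (hcu' : ⟪c, u'⟫ = 1)
    {ca κ : ℝ} (hca1 : ca < 1) (hp : ⟪v, u⟫ ≤ ca) (hp' : ⟪v, u'⟫ ≤ ca) (hκ0 : 0 ≤ κ)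
    (h2κ : 2 * κ ^ 2 ≤ 1) (hsmall : κ ^ 2 * (1 + ca) * (‖c‖ ^ 2 - 1) ≤ 1 - ca) :
    (2 * κ ^ 2 - 1) * (‖u - ⟪v, u⟫ • v‖ * ‖u' - ⟪v, u'⟫ • v‖) ≤
      ⟪u - ⟪v, u⟫ • v, u' - ⟪v, u'⟫ • v⟫ := by
  have hc1 : 1 < ‖c‖ := one_lt_norm_of_two_tight hu hv huv hcu hcv
  have hcv0 : c ≠ v := by
    intro h
    rw [h, hv] at hc1
    exact lt_irrefl _ hc1
  have hg0 : 0 < ‖c - v‖ := norm_pos_iff.2 (sub_ne_zero.2 hcv0)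
  set g : EuclideanSpace ℝ (Fin 3) := ‖c - v‖⁻¹ • (c - v) with hg
  have hg1 : ‖g‖ = 1 := by
    rw [hg, norm_smul, norm_inv, norm_norm, inv_mul_cancel₀ hg0.ne']
  have key : ∀ w : EuclideanSpace ℝ (Fin 3), ‖w‖ = 1 → ⟪c, w⟫ = 1 → ⟪v, w⟫ ≤ ca →
      κ * ‖w - ⟪v, w⟫ • v‖ ≤ ⟪w - ⟪v, w⟫ • v, g⟫ := by
    intro w hw hcw hpw
    have h := inner_sub_smul_sub_ge hv hw hcv hcw hca1 hpw hκ0 hsmall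
    rw [hg, real_inner_smul_right, le_inv_mul_iff₀ hg0]
    calc ‖c - v‖ * (κ * ‖w - ⟪v, w⟫ • v‖) = κ * (‖w - ⟪v, w⟫ • v‖ * ‖c - v‖) := by ring
      _ ≤ _ := h
  exact inner_ge_of_inner_ge_mul_norm hg1 hκ0 h2κ (key u hu hcu hp) (key u' hu' hcu' hp')

/-- **Every facet corner of the twelve link directions is below `136.9°`** (conditional on
Tammes-13).  For at least twelve unit vectors `X` pairwise at inner product
`≤ ca = 1 − 1/(2·(101/100)²)`, a supporting functional `c` (`⟪c, ·⟫ ≤ 1` on `X`) and three of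
its tight points `v, u, u' ∈ X` with `u ≠ v`, `u' ≠ v`: the corner at `v` has cosine
`≥ 2·(135/1000) − 1 = −0.73`.  (`FacetCap`: `‖c‖² < (2/(2 − 0.957²))²`, and
`(135/1000)(1 + ca)((2/(2 − 0.957²))² − 1) ≤ 1 − ca` in exact arithmetic, margin `9·10⁻⁵`.)
[cite: MusinTarasov2012, Theorem 1] -/
theorem facet_corner_cos_ge_one_percent (hT : musinTarasov2012_tammes_thirteen)
    {X : Finset (EuclideanSpace ℝ (Fin 3))} (hX1 : ∀ y ∈ X, ‖y‖ = 1) (hcard : 12 ≤ X.card)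
    (hsep : ∀ u ∈ X, ∀ v ∈ X, u ≠ v → ⟪u, v⟫ ≤ 1 - 1 / (2 * (101 / 100 : ℝ) ^ 2))
    {c : EuclideanSpace ℝ (Fin 3)} (hc : ∀ y ∈ X, ⟪c, y⟫ ≤ 1) {v u u' : EuclideanSpace ℝ (Fin 3)}
    (hv : v ∈ X) (hu : u ∈ X) (hu' : u' ∈ X) (huv : u ≠ v) (hu'v : u' ≠ v) (hcv : ⟪c, v⟫ = 1)
    (hcu : ⟪c, u⟫ = 1) (hcu' : ⟪c, u'⟫ = 1) :
    (2 * (135 / 1000 : ℝ) - 1) * (‖u - ⟪v, u⟫ • v‖ * ‖u' - ⟪v, u'⟫ • v‖) ≤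
      ⟪u - ⟪v, u⟫ • v, u' - ⟪v, u'⟫ • v⟫ := by
  -- chordal separation and the Tammes bound on `‖c‖`
  have hdist : ∀ a ∈ X, ∀ b ∈ X, a ≠ b → (0.957 : ℝ) ≤ dist a b := by
    intro a ha b hb hab
    have hd : dist a b ^ 2 = 2 - 2 * ⟪a, b⟫ := by
      rw [dist_eq_norm, ← real_inner_self_eq_norm_sq, inner_sub_left, inner_sub_right,
        inner_sub_right, real_inner_self_eq_norm_sq, real_inner_self_eq_norm_sq, hX1 a ha,
        hX1 b hb, real_inner_comm a b]
      ring
    have h2 : (0.957 : ℝ) ^ 2 ≤ dist a b ^ 2 := by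
      rw [hd]; have := hsep a ha b hb hab; norm_num at this ⊢; linarith
    exact (pow_le_pow_iff_left₀ (by norm_num) dist_nonneg two_ne_zero).1 h2
  have hnorm := norm_lt_of_forall_inner_le_one hT hX1 hcard hdist hc
  have hK : ‖c‖ ^ 2 < (2 / (2 - 0.957 ^ 2)) ^ 2 :=
    pow_lt_pow_left₀ hnorm (norm_nonneg c) two_ne_zero
  have hsqrt : Real.sqrt (135 / 1000) ^ 2 = 135 / 1000 := Real.sq_sqrt (by norm_num)
  have h := facet_corner_cos_ge (hX1 v hv) (hX1 u hu) (hX1 u' hu') huv hcv hcu hcu'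
    (ca := 1 - 1 / (2 * (101 / 100 : ℝ) ^ 2)) (κ := Real.sqrt (135 / 1000)) (by norm_num)
    (hsep v hv u hu huv.symm) (hsep v hv u' hu' hu'v.symm) (Real.sqrt_nonneg _)
    (by rw [hsqrt]; norm_num) ?_
  · rwa [hsqrt] at h
  · rw [hsqrt]
    norm_num at hK ⊢
    nlinarith [hK]

end Summit.AtomisticToContinuum.Crystallization.Theorems
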